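import Mathlib
import HarnessLib

/-!
# Compound rules (Davis–Rabinowitz 1984, Sect. 2.4)

Davis–Rabinowitz, *Methods of Numerical Integration* (2nd ed., 1984), Sect. 2.4 "Compound Rules", pp. 70–72:
an `m`-point rule `R(f) = Σ_k w_k f(t_k)` on `[-1, 1]` is transferred to a panel `[α, β]` by the affine map
(2.4.3)–(2.4.5) (`affineRule`) and applied to each of the `n` equal panels of `[a, b]`: the compound rule
`n × R` (2.4.6) (`compoundRule`, `compoundRule_eq`).  The two theorems of the section:

* **Theorem (2.4.7)** `tendsto_compoundRule`: if `R(1) = 2` then `(n × R)(f) → ∫_a^b f` — by the book's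
  rearrangement `(n × R)(f) = Σ_k w_k (b - a)/(2n) Σ_i f(y_{ki})` (`compoundRule_eq_sum_weight_mul`), each inner
  sum being a Riemann sum (recorded for continuous `f`; the book allows bounded Riemann-integrable `f`);
* **Theorem (2.4.8)–(2.4.9)** `tendsto_pow_mul_integral_sub_compoundRule(_of_hasDerivAt)`: for a *simplex* rule,
  `E_R(f) = c(β - α)^{k+1} f^{(k)}(ξ)` on every panel,
  `lim n^k E_{n × R}(f) = c(b - a)^k (f^{(k-1)}(b) - f^{(k-1)}(a))` ("converges with rapidity `n^{-k}`";
  the book's Example: Simpson, `c = -1/2880`, `k = 4`).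

Both rest on the convergence of tagged Riemann sums of a continuous function (private, via uniform continuity
and the panel decomposition `|∫ g - h Σ g(τ_i)| ≤ (b - a) ω`).

Provenance: engines group, shared numerical engines serving client cells; rigour lives in the verifiers; every
published number belongs to a client cell's ledger, not to the engines group.  This file records textbook
facts only (no client numbers).
-/

namespace Literature.Analysis.Quadrature

open Set MeasureTheory intervalIntegral Finset Filter Topology
open scoped Real Interval

noncomputable section

variable {ι : Type*} [Fintype ι]

/-- An `m`-point rule `R(f) = Σ_k w_k f(t_k)` on `[-1, 1]` transferred affinely to `[α, β]` ((2.4.3)–(2.4.5)):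
`R_{[α,β]}(f) = (β - α)/2 · Σ_k w_k f(α + (β - α)(1 + t_k)/2)`.
[cite: DavisRabinowitz1984, Sect. 2.4 (2.4.5)] -/
def affineRule (w t : ι → ℝ) (α β : ℝ) (f : ℝ → ℝ) : ℝ :=
  (β - α) / 2 * ∑ k, w k * f (α + (β - α) / 2 * (1 + t k))

/-- The compound rule `n × R` on `[a, b]` (2.4.6): `R` applied to each of the `n` panels
`[x_{i-1}, x_i]`, `x_i = a + i(b - a)/n`. [cite: DavisRabinowitz1984, Sect. 2.4 (2.4.6)] -/
def compoundRule (w t : ι → ℝ) (n : ℕ) (a b : ℝ) (f : ℝ → ℝ) : ℝ :=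
  ∑ i ∈ range n, affineRule w t (a + i * (b - a) / n) (a + (i + 1) * (b - a) / n) f

/-- On `[-1, 1]` the transferred rule is `R` itself. [cite: DavisRabinowitz1984, Sect. 2.4 (2.4.5)] -/
theorem affineRule_neg_one_one (w t : ι → ℝ) (f : ℝ → ℝ) :
    affineRule w t (-1) 1 f = ∑ k, w k * f (t k) := by
  unfold affineRule
  have : ∀ k, (-1 : ℝ) + (1 - -1) / 2 * (1 + t k) = t k := fun k => by ring
  simp_rw [this]
  norm_num

/-- `1 × R = R_{[a,b]}`. [cite: DavisRabinowitz1984, Sect. 2.4 (2.4.6)] -/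
theorem compoundRule_one (w t : ι → ℝ) (a b : ℝ) (f : ℝ → ℝ) :
    compoundRule w t 1 a b f = affineRule w t a b f := by
  simp [compoundRule]

/-- (2.4.6), displayed form: `(n × R)(f) = (b - a)/(2n) Σ_{i=1}^{n} Σ_k w_k f(y_{ki})` with
`y_{ki} = x_{i-1} + (b - a)(1 + t_k)/(2n)` (2.4.5). [cite: DavisRabinowitz1984, Sect. 2.4 (2.4.6)] -/
theorem compoundRule_eq (w t : ι → ℝ) (n : ℕ) (a b : ℝ) (f : ℝ → ℝ) :
    compoundRule w t n a b f =
      (b - a) / (2 * n) *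
        ∑ i ∈ range n, ∑ k, w k * f (a + i * (b - a) / n + (b - a) / (2 * n) * (1 + t k)) := by
  rcases Nat.eq_zero_or_pos n with rfl | hn
  · simp [compoundRule]
  have hn' : (n : ℝ) ≠ 0 := by positivity
  unfold compoundRule affineRule
  rw [Finset.mul_sum]
  refine Finset.sum_congr rfl fun i _ => ?_
  have h1 : (a + (i + 1) * (b - a) / n - (a + i * (b - a) / n)) / 2 = (b - a) / (2 * n) := by
    field_simp
    ring
  rw [h1]

/-- The rearrangement used in the proof of (2.4.7): `(n × R)(f) = Σ_k w_k · [(b - a)/(2n) Σ_i f(y_{ki})]`.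
[cite: DavisRabinowitz1984, Sect. 2.4 (2.4.7)] -/
theorem compoundRule_eq_sum_weight_mul (w t : ι → ℝ) (n : ℕ) (a b : ℝ) (f : ℝ → ℝ) :
    compoundRule w t n a b f =
      ∑ k, w k *
        ((b - a) / (2 * n) * ∑ i ∈ range n, f (a + i * (b - a) / n + (b - a) / (2 * n) * (1 + t k))) := by
  rw [compoundRule_eq, Finset.mul_sum]
  simp_rw [Finset.mul_sum]
  rw [Finset.sum_comm]
  refine Finset.sum_congr rfl fun k _ => Finset.sum_congr rfl fun i _ => ?_
  ring

/-! ### Tagged Riemann sums of a continuous function (the limit used in both proofs) -/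

/-- [folklore] panel decomposition: for tags `τ_i` in the `i`-th panel, `|∫_a^b g - h Σ_i g(τ_i)| ≤ (b - a) ω`
whenever `|g(x₁) - g(x₂)| ≤ ω` for `|x₁ - x₂| ≤ h`, `h = (b - a)/n` (private copy of the tree's
rectangular-rule lemma). -/
private theorem abs_integral_sub_taggedSum_le {g : ℝ → ℝ} {a b : ℝ} (hab : a ≤ b) {n : ℕ}
    (hn : 0 < n) (hgi : IntervalIntegrable g volume a b) {ω : ℝ}
    (hω : ∀ x ∈ Icc a b, ∀ y ∈ Icc a b, |x - y| ≤ (b - a) / n → |g x - g y| ≤ ω)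
    {τ : ℕ → ℝ} (hτ : ∀ i < n, τ i ∈ Icc (a + i * (b - a) / n) (a + (i + 1) * (b - a) / n)) :
    |(∫ x in a..b, g x) - (b - a) / n * ∑ i ∈ range n, g (τ i)| ≤ (b - a) * ω := by
  have hn' : (n : ℝ) ≠ 0 := by positivity
  set s : ℕ → ℝ := fun i => a + i * (b - a) / n with hs
  have hs0 : s 0 = a := by simp [hs]
  have hsn : s n = b := by simp only [hs]; field_simp; ring
  have hstep : ∀ i : ℕ, s (i + 1) - s i = (b - a) / n := fun i => by
    simp only [hs]; push_cast; ring
  have hs1 : ∀ i : ℕ, s (i + 1) = a + (i + 1) * (b - a) / n := fun i => by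
    simp only [hs]; push_cast; ring
  have hh : 0 ≤ (b - a) / n := div_nonneg (sub_nonneg.2 hab) (Nat.cast_nonneg n)
  have hmono : ∀ i, s i ≤ s (i + 1) := fun i => by linarith [hstep i]
  have hsI : ∀ i ≤ n, s i ∈ Icc a b := by
    intro i hi
    have hn0 : (0 : ℝ) < n := by exact_mod_cast hn
    constructor
    · have : 0 ≤ (i : ℝ) * (b - a) / n :=
        div_nonneg (mul_nonneg (Nat.cast_nonneg i) (sub_nonneg.2 hab)) hn0.le
      simp only [hs]
      linarith
    · have hi' : (i : ℝ) * (b - a) ≤ n * (b - a) :=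
        mul_le_mul_of_nonneg_right (by exact_mod_cast hi) (sub_nonneg.2 hab)
      have : (i : ℝ) * (b - a) / n ≤ b - a := by
        rw [div_le_iff₀ hn0]
        linarith
      simp only [hs]
      linarith
  have hint : ∀ i < n, IntervalIntegrable g volume (s i) (s (i + 1)) := fun i hi =>
    hgi.mono_set (by
      rw [uIcc_of_le hab, uIcc_of_le (hmono i)]
      exact Icc_subset_Icc (hsI i hi.le).1 (hsI (i + 1) hi).2)
  have hsplit : (∫ x in a..b, g x) = ∑ i ∈ range n, ∫ x in s i..s (i + 1), g x := by
    rw [sum_integral_adjacent_intervals hint, hs0, hsn]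
  have hsum : (b - a) / n * ∑ i ∈ range n, g (τ i) = ∑ i ∈ range n, ∫ _ in s i..s (i + 1), g (τ i) := by
    rw [Finset.mul_sum]
    refine Finset.sum_congr rfl fun i _ => ?_
    rw [intervalIntegral.integral_const, hstep, smul_eq_mul]
  rw [hsplit, hsum, ← Finset.sum_sub_distrib]
  calc |∑ i ∈ range n, ((∫ x in s i..s (i + 1), g x) - ∫ _ in s i..s (i + 1), g (τ i))|
      ≤ ∑ i ∈ range n, |(∫ x in s i..s (i + 1), g x) - ∫ _ in s i..s (i + 1), g (τ i)| :=
        Finset.abs_sum_le_sum_abs _ _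
    _ ≤ ∑ i ∈ range n, (b - a) / n * ω := by
        refine Finset.sum_le_sum fun i hi => ?_
        have hin : i < n := Finset.mem_range.1 hi
        rw [← intervalIntegral.integral_sub (hint i hin) intervalIntegrable_const]
        have hτi := hτ i hin
        rw [← hs1 i] at hτi
        have h2 := intervalIntegral.norm_integral_le_of_norm_le_const (a := s i) (b := s (i + 1))
          (C := ω) (f := fun x => g x - g (τ i)) fun x hx => ?_
        · rw [hstep i, abs_of_nonneg hh, Real.norm_eq_abs, mul_comm] at h2
          exact h2
        · rw [uIoc_of_le (hmono i)] at hx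
          have hxI : x ∈ Icc a b := ⟨(hsI i hin.le).1.trans hx.1.le, hx.2.trans (hsI (i + 1) hin).2⟩
          have hτI : τ i ∈ Icc a b := ⟨(hsI i hin.le).1.trans hτi.1, hτi.2.trans (hsI (i + 1) hin).2⟩
          rw [Real.norm_eq_abs]
          refine hω x hxI (τ i) hτI ?_
          rw [abs_le]
          constructor <;> linarith [hx.1, hx.2, hτi.1, hτi.2, hstep i]
    _ = (b - a) * ω := by
        rw [Finset.sum_const, Finset.card_range, nsmul_eq_mul]
        field_simp

/-- [folklore] tagged Riemann sums of a continuous function converge to the integral, whatever the tags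
(uniform continuity on `[a, b]`). -/
private theorem tendsto_taggedSum {g : ℝ → ℝ} {a b : ℝ} (hab : a ≤ b) (hg : ContinuousOn g (Icc a b))
    {τ : ℕ → ℕ → ℝ}
    (hτ : ∀ n i : ℕ, i < n → τ n i ∈ Icc (a + i * (b - a) / n) (a + (i + 1) * (b - a) / n)) :
    Tendsto (fun n : ℕ => (b - a) / n * ∑ i ∈ range n, g (τ n i)) atTop (𝓝 (∫ x in a..b, g x)) := by
  have hgi : IntervalIntegrable g volume a b := (hg.mono (by rw [uIcc_of_le hab])).intervalIntegrable
  rw [Metric.tendsto_atTop]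
  intro ε hε
  -- uniform continuity: `|x - y| ≤ δ ⇒ |g x - g y| ≤ ε / (2 (b - a + 1))`
  set ω : ℝ := ε / (2 * (b - a + 1)) with hω
  have hba1 : 0 < b - a + 1 := by linarith
  have hωpos : 0 < ω := div_pos hε (by positivity)
  obtain ⟨δ, hδ, hU⟩ :=
    Metric.uniformContinuousOn_iff.1 (isCompact_Icc.uniformContinuousOn_of_continuous hg) ω hωpos
  -- choose `N` with `(b - a)/N < δ`
  obtain ⟨N, hN⟩ := exists_nat_gt ((b - a) / δ)
  refine ⟨max N 1, fun n hn => ?_⟩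
  have hn1 : 1 ≤ n := le_of_max_le_right hn
  have hnN : (N : ℝ) ≤ n := by exact_mod_cast le_of_max_le_left hn
  have hn0 : (0 : ℝ) < n := by exact_mod_cast hn1
  have hhδ : (b - a) / n < δ := by
    rw [div_lt_iff₀ hn0]
    have := (div_lt_iff₀ hδ).1 (hN.trans_le hnN)
    linarith
  have key := abs_integral_sub_taggedSum_le hab hn1 hgi (ω := ω) (fun x hx y hy hxy => by
    have := hU x hx y hy (by rw [Real.dist_eq]; exact hxy.trans_lt hhδ)
    rw [Real.dist_eq] at this
    exact this.le) (fun i hi => hτ n i hi)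
  rw [Real.dist_eq, abs_sub_comm]
  calc |(∫ x in a..b, g x) - (b - a) / n * ∑ i ∈ range n, g (τ n i)| ≤ (b - a) * ω := key
    _ < ε := by
        rw [hω, ← sub_pos]
        have : ε - (b - a) * (ε / (2 * (b - a + 1))) = ε * (b - a + 2) / (2 * (b - a + 1)) := by
          field_simp
          ring
        rw [this]
        exact div_pos (mul_pos hε (by linarith)) (by positivity)

/-! ### (2.4.7): convergence of compound rules -/

/-- **Theorem (2.4.7)**: if `R(1) = ∫_{-1}^{1} dx = 2` (i.e. `Σ w_k = 2`; abscissas in `[-1, 1]`), then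
`lim_{n → ∞} (n × R)(f) = ∫_a^b f` — the book states it for bounded Riemann-integrable `f`; recorded for `f`
continuous on `[a, b]` (each `(b - a)/n Σ_i f(y_{ki})` is a Riemann sum).
[cite: DavisRabinowitz1984, Sect. 2.4 (2.4.7)] -/
theorem tendsto_compoundRule {w t : ι → ℝ} (hw : ∑ k, w k = 2) (ht : ∀ k, t k ∈ Icc (-1 : ℝ) 1)
    {f : ℝ → ℝ} {a b : ℝ} (hab : a ≤ b) (hf : ContinuousOn f (Icc a b)) :
    Tendsto (fun n => compoundRule w t n a b f) atTop (𝓝 (∫ x in a..b, f x)) := by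
  have hform : (fun n => compoundRule w t n a b f) = fun n : ℕ =>
      ∑ k, w k * (1 / 2 *
        ((b - a) / n * ∑ i ∈ range n, f (a + i * (b - a) / n + (b - a) / (2 * n) * (1 + t k)))) := by
    funext n
    rw [compoundRule_eq_sum_weight_mul]
    refine Finset.sum_congr rfl fun k _ => ?_
    rcases Nat.eq_zero_or_pos n with rfl | hn
    · simp
    · have hn' : (n : ℝ) ≠ 0 := by positivity
      congr 1
      rw [← mul_assoc]
      congr 1
      field_simp
  rw [hform]
  have hlim : ∀ k, Tendsto
      (fun n : ℕ => (b - a) / n * ∑ i ∈ range n, f (a + i * (b - a) / n + (b - a) / (2 * n) * (1 + t k)))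
      atTop (𝓝 (∫ x in a..b, f x)) := by
    intro k
    refine tendsto_taggedSum hab hf fun (n i : ℕ) (hi : i < n) => ?_
    have hn0 : (0 : ℝ) < n := by exact_mod_cast (Nat.zero_le i).trans_lt hi
    have hh : 0 ≤ (b - a) / n := div_nonneg (sub_nonneg.2 hab) hn0.le
    obtain ⟨ht1, ht2⟩ := ht k
    constructor
    · have : 0 ≤ (b - a) / (2 * n) * (1 + t k) := mul_nonneg (by positivity) (by linarith)
      linarith
    · have h1 : (b - a) / (2 * n) * (1 + t k) ≤ (b - a) / (2 * n) * 2 :=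
        mul_le_mul_of_nonneg_left (by linarith) (by positivity)
      have h2 : (a + (i + 1) * (b - a) / n) - (a + i * (b - a) / n) = (b - a) / (2 * n) * 2 := by
        field_simp
        ring
      linarith
  have := tendsto_finsetSum (Finset.univ : Finset ι) fun k _ => (hlim k).const_mul (w k * (1 / 2))
  simp_rw [← mul_assoc] at this ⊢
  convert this using 2
  have h2 : ∑ i, w i * (1 / 2 : ℝ) = 1 := by
    rw [← Finset.sum_mul, hw]
    norm_num
  rw [← Finset.sum_mul, h2, one_mul]

/-! ### (2.4.8)–(2.4.9): simplex rules and the asymptotic error of their compound rules -/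

/-- **Theorem (2.4.8)–(2.4.9)** (asymptotic error of compound *simplex* rules): suppose that on every panel
`[α, β] ⊆ [a, b]` the rule has an error of the form
`E_R(f) = ∫_α^β f - R_{[α,β]}(f) = c(β - α)^{k+1} g(ξ)`, `ξ ∈ [α, β]` (2.4.8) (for `f ∈ C^k`, `g = f^{(k)}`;
`c` independent of `α, β`), with `g` continuous on `[a, b]`.
Then `lim_{n → ∞} n^k E_{n × R}(f) = c(b - a)^k ∫_a^b g` ( `= c(b - a)^k (f^{(k-1)}(b) - f^{(k-1)}(a))`, next
statement).  The book's `α < ξ < β` version is the special case of this hypothesis.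
[cite: DavisRabinowitz1984, Sect. 2.4 (2.4.9)] -/
theorem tendsto_pow_mul_integral_sub_compoundRule {w t : ι → ℝ} {f g : ℝ → ℝ} {a b c : ℝ} {k : ℕ}
    (hab : a ≤ b) (hfi : IntervalIntegrable f volume a b) (hg : ContinuousOn g (Icc a b))
    (hR : ∀ α β, a ≤ α → α ≤ β → β ≤ b →
      ∃ ξ ∈ Icc α β, (∫ x in α..β, f x) - affineRule w t α β f = c * (β - α) ^ (k + 1) * g ξ) :
    Tendsto (fun n : ℕ => (n : ℝ) ^ k * ((∫ x in a..b, f x) - compoundRule w t n a b f)) atTop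
      (𝓝 (c * (b - a) ^ k * ∫ x in a..b, g x)) := by
  -- panel points and the chosen `ξ_i`
  set s : ℕ → ℕ → ℝ := fun n i => a + i * (b - a) / n with hs
  have hsI : ∀ n i, 0 < n → i ≤ n → s n i ∈ Icc a b := by
    intro n i hn hi
    have hn0 : (0 : ℝ) < n := by exact_mod_cast hn
    constructor
    · have : 0 ≤ (i : ℝ) * (b - a) / n := div_nonneg (mul_nonneg (Nat.cast_nonneg i) (sub_nonneg.2 hab)) hn0.le
      simp only [hs]
      linarith
    · have hi' : (i : ℝ) * (b - a) ≤ n * (b - a) :=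
        mul_le_mul_of_nonneg_right (by exact_mod_cast hi) (sub_nonneg.2 hab)
      have : (i : ℝ) * (b - a) / n ≤ b - a := by
        rw [div_le_iff₀ hn0]
        linarith
      simp only [hs]
      linarith
  have hs1 : ∀ n i : ℕ, s n (i + 1) = a + (i + 1) * (b - a) / n := fun n i => by simp only [hs]; push_cast; ring
  have hmono : ∀ n i : ℕ, 0 < n → s n i ≤ s n (i + 1) := fun n i hn => by
    have hn0 : (0 : ℝ) < n := by exact_mod_cast hn
    have : s n (i + 1) - s n i = (b - a) / n := by simp only [hs]; push_cast; ring
    have h2 : 0 ≤ (b - a) / n := div_nonneg (sub_nonneg.2 hab) hn0.le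
    linarith
  have hex : ∀ n i, 0 < n → i < n → ∃ ξ ∈ Icc (s n i) (s n (i + 1)),
      (∫ x in s n i..s n (i + 1), f x) - affineRule w t (s n i) (s n (i + 1)) f =
        c * (s n (i + 1) - s n i) ^ (k + 1) * g ξ :=
    fun n i hn hi => hR _ _ (hsI n i hn hi.le).1 (hmono n i hn) (hsI n (i + 1) hn hi).2
  classical
  let τ : ℕ → ℕ → ℝ := fun n i => if h : 0 < n ∧ i < n then (hex n i h.1 h.2).choose else a
  have hτ : ∀ n i, 0 < n → i < n → τ n i ∈ Icc (s n i) (s n (i + 1)) ∧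
      (∫ x in s n i..s n (i + 1), f x) - affineRule w t (s n i) (s n (i + 1)) f =
        c * (s n (i + 1) - s n i) ^ (k + 1) * g (τ n i) := by
    intro n i hn hi
    have h : 0 < n ∧ i < n := ⟨hn, hi⟩
    simp only [τ, dif_pos h]
    exact (hex n i hn hi).choose_spec
  -- the error of the compound rule is `c h^k · (h Σ_i g(ξ_i))`
  have herr : ∀ n : ℕ, 0 < n → (n : ℝ) ^ k * ((∫ x in a..b, f x) - compoundRule w t n a b f) =
      c * (b - a) ^ k * ((b - a) / n * ∑ i ∈ range n, g (τ n i)) := by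
    intro n hn
    have hn' : (n : ℝ) ≠ 0 := by positivity
    have hint : ∀ i < n, IntervalIntegrable f volume (s n i) (s n (i + 1)) := fun i hi =>
      hfi.mono_set (by
        rw [uIcc_of_le hab, uIcc_of_le (hmono n i hn)]
        exact Icc_subset_Icc (hsI n i hn hi.le).1 (hsI n (i + 1) hn hi).2)
    have hs0 : s n 0 = a := by simp [hs]
    have hsn : s n n = b := by simp only [hs]; field_simp; ring
    have hsplit : (∫ x in a..b, f x) = ∑ i ∈ range n, ∫ x in s n i..s n (i + 1), f x := by
      rw [sum_integral_adjacent_intervals hint, hs0, hsn]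
    have hcomp : compoundRule w t n a b f = ∑ i ∈ range n, affineRule w t (s n i) (s n (i + 1)) f := by
      unfold compoundRule
      refine Finset.sum_congr rfl fun i _ => ?_
      rw [hs1]
    have hstep : ∀ i : ℕ, s n (i + 1) - s n i = (b - a) / n := fun i => by simp only [hs]; push_cast; ring
    rw [hsplit, hcomp, ← Finset.sum_sub_distrib, Finset.sum_congr rfl fun i hi => (hτ n i hn (mem_range.1 hi)).2]
    simp_rw [hstep]
    rw [Finset.mul_sum, Finset.mul_sum, Finset.mul_sum]
    refine Finset.sum_congr rfl fun i _ => ?_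
    have hnk : (n : ℝ) ^ k * ((b - a) / n) ^ k = (b - a) ^ k := by
      rw [← mul_pow, mul_div_cancel₀ _ hn']
    calc (n : ℝ) ^ k * (c * ((b - a) / n) ^ (k + 1) * g (τ n i))
        = c * ((n : ℝ) ^ k * ((b - a) / n) ^ k) * ((b - a) / n * g (τ n i)) := by ring
      _ = c * (b - a) ^ k * ((b - a) / n * g (τ n i)) := by rw [hnk]
  have hlim := (tendsto_taggedSum hab hg (τ := τ) fun (n i : ℕ) (hi : i < n) => by
    have hn : 0 < n := (Nat.zero_le i).trans_lt hi
    have := (hτ n i hn hi).1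
    rwa [hs1] at this).const_mul (c * (b - a) ^ k)
  refine (hlim.congr' ?_)
  filter_upwards [eventually_gt_atTop 0] with n hn
  exact (herr n hn).symm

/-- (2.4.9) in the book's form: with `G' = g` on `[a, b]` (`G = f^{(k-1)}`, `g = f^{(k)}`),
`lim_{n → ∞} n^k E_{n × R}(f) = c(b - a)^k (f^{(k-1)}(b) - f^{(k-1)}(a))` — "the family of compound rules
converges with rapidity `n^{-k}`" (e.g. Simpson: `c = -1/2880`, `k = 4`).
[cite: DavisRabinowitz1984, Sect. 2.4 (2.4.9)] -/
theorem tendsto_pow_mul_integral_sub_compoundRule_of_hasDerivAt {w t : ι → ℝ} {f g G : ℝ → ℝ} {a b c : ℝ}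
    {k : ℕ} (hab : a ≤ b) (hfi : IntervalIntegrable f volume a b) (hg : ContinuousOn g (Icc a b))
    (hG : ∀ x ∈ Icc a b, HasDerivAt G (g x) x)
    (hR : ∀ α β, a ≤ α → α ≤ β → β ≤ b →
      ∃ ξ ∈ Icc α β, (∫ x in α..β, f x) - affineRule w t α β f = c * (β - α) ^ (k + 1) * g ξ) :
    Tendsto (fun n : ℕ => (n : ℝ) ^ k * ((∫ x in a..b, f x) - compoundRule w t n a b f)) atTop
      (𝓝 (c * (b - a) ^ k * (G b - G a))) := by
  have hI : [[a, b]] = Icc a b := uIcc_of_le hab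
  have hint : ∫ x in a..b, g x = G b - G a :=
    integral_eq_sub_of_hasDerivAt (fun x hx => hG x (hI ▸ hx)) ((hg.mono (by rw [hI])).intervalIntegrable)
  rw [← hint]
  exact tendsto_pow_mul_integral_sub_compoundRule hab hfi hg hR

end

end Literature.Analysis.Quadrature
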